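import Summits.Ventures.PercRepro.StarGadgetGraphBot
import Summits.Ventures.PercRepro.StarGadgetGraphProfiles
import Summits.Ventures.PercRepro.C026HGraph

/-!
# The star gadget — the H-adjacency tables (graph half, module 3b)

For a configuration in mode `μ` (`InMode μ ω`: `Local`, and the centre attaches exactly to the mark
of `μ`), the H-graph of `C026HGraph` (`HAdj ω c`, `c = vm 2`, `M = cluster ω c`) restricted to the
centrals and one hub is read off the hub's type and state: `hadj_cen_inr_iff` (the profile formula
`Hf`), `hadj_cen_cen_iff` (the constant table `T2`), and the cluster memberships (`inCl`, `nx`).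
Everything is a direct computation with Lemma (B) (`cluster_mark_eq`, `cluster_x_eq`) and the edge
bookkeeping of the gadget.
-/

namespace PercRepro.StarGadgetGraph

open MultiGraph

variable {cx : Bool} {p q r s : ℕ}

/-- The central `i` (`a b c x = 0 1 2 3`) as a vertex. -/
def cen (i : Fin 4) : V p q r s := Sum.inl i

/-- `vm m` is the central `m`. -/
theorem vm_eq_cen (m : Fin 3) : (vm m : V p q r s) = cen m.castSucc := rfl

/-- `vx` is the central `3`. -/
theorem vx_eq_cen : (vx : V p q r s) = cen 3 := rfl

/-- The centrals are `Cen`. -/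
theorem cen_mem_cen (i : Fin 4) : cen i ∈ Cen p q r s := ⟨i, rfl⟩

/-- `Cen` is the range of `cen`. -/
theorem cen_eq_range : Cen p q r s = Set.range (cen : Fin 4 → V p q r s) := rfl

/-- `cen` is injective. -/
theorem cen_injective : Function.Injective (cen : Fin 4 → V p q r s) := Sum.inl_injective

/-- A vertex is a central or a hub. -/
theorem eq_cen_or_eq_inr (v : V p q r s) : (∃ i, v = cen i) ∨ ∃ h, v = Sum.inr h := by
  rcases v with i | h
  · exact Or.inl ⟨i, rfl⟩
  · exact Or.inr ⟨h, rfl⟩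

/-- The list of marks of a hub type has no repetition. -/
theorem HubType.marks_nodup (T : HubType) : T.marks.Nodup := by
  cases T <;> decide

/-- `xOpen` is the state predicate `xo`. -/
theorem xOpen_iff (ω : Config (E cx p q r s)) (h : Hub p q r s) :
    xOpen ω h ↔ xo (hubState ω h) := Iff.rfl

/-- `markOpen` is the state predicate `mo`. -/
theorem markOpen_iff (ω : Config (E cx p q r s)) (h : Hub p q r s) (m : Fin 3) :
    markOpen ω h m ↔ mo (hubState ω h) m := Iff.rfl

/-! ### Modes -/

/-- A configuration is in mode `μ`: it is `Local` (= `bot`) and the centre attaches exactly to the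
mark of `μ` (to no mark for `μ = none`). -/
def InMode (μ : Mode) (ω : Config (E cx p q r s)) : Prop :=
  Local ω ∧ ∀ m, Att ω m ↔ μ = some m

/-- The cluster of the mark `m'` contains the mark `m` iff `m = m'` (under `Local`). -/
theorem vm_mem_cluster_vm_iff {ω : Config (E cx p q r s)} (hL : Local ω) (m m' : Fin 3) :
    (vm m : V p q r s) ∈ (starGadget cx p q r s).cluster ω (vm m') ↔ m = m' := by
  rw [cluster_mark_eq ω hL m', vm_mem_K_iff]

/-- A hub lies in the cluster of the mark `m` iff its state says so (`inCl`). -/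
theorem inr_mem_cluster_vm_iff {μ : Mode} {ω : Config (E cx p q r s)} (hμ : InMode μ ω)
    (m : Fin 3) (h : Hub p q r s) :
    (Sum.inr h : V p q r s) ∈ (starGadget cx p q r s).cluster ω (vm m) ↔
      inCl μ m (hubType h) (hubState ω h) := by
  rw [cluster_mark_eq ω hμ.1 m, inr_mem_K_iff, hμ.2 m]
  rfl

/-- The centre lies in the cluster of the mark `m` iff the mode is `m`. -/
theorem vx_mem_cluster_vm_iff' {μ : Mode} {ω : Config (E cx p q r s)} (hμ : InMode μ ω)
    (m : Fin 3) : (vx : V p q r s) ∈ (starGadget cx p q r s).cluster ω (vm m) ↔ μ = some m := by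
  rw [vx_mem_cluster_mark_iff ω hμ.1 m, hμ.2 m]

/-- When the centre attaches to `m`, its cluster is the cluster of `m`. -/
theorem cluster_vx_eq_of_att {ω : Config (E cx p q r s)} {m : Fin 3} (hA : Att ω m) :
    (starGadget cx p q r s).cluster ω vx = (starGadget cx p q r s).cluster ω (vm m) :=
  cluster_eq_of_conn (starGadget cx p q r s) (conn_vm_vx_of_att hA).symm

/-- A hub lies in the cluster of the centre iff its `x`-edge is open, or its `x`-edge is closed
and it hangs from the mark the centre attaches to. -/
theorem inr_mem_cluster_vx_iff {μ : Mode} {ω : Config (E cx p q r s)} (hμ : InMode μ ω)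
    (h : Hub p q r s) :
    (Sum.inr h : V p q r s) ∈ (starGadget cx p q r s).cluster ω vx ↔
      xo (hubState ω h) ∨ (¬ xo (hubState ω h) ∧ ∃ m, μ = some m ∧ mo (hubState ω h) m) := by
  rcases hμμ : μ with _ | m
  · have hR : ∀ m, ¬ Att ω m := fun m hA => by simpa [hμμ] using (hμ.2 m).1 hA
    rw [cluster_x_eq ω hR, mem_XR_iff]
    constructor
    · rintro (h1 | ⟨h', h1, hx⟩)
      · exact absurd h1.symm (vx_ne_inr _)
      · obtain rfl := Sum.inr.inj h1
        exact Or.inl hx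
    · rintro (hx | ⟨-, m, hm, -⟩)
      · exact Or.inr ⟨h, rfl, hx⟩
      · cases hm
  · have hA : Att ω m := (hμ.2 m).2 hμμ
    rw [cluster_vx_eq_of_att hA, cluster_mark_eq ω hμ.1 m, inr_mem_K_iff]
    constructor
    · rintro (⟨hx, hm⟩ | ⟨-, hx⟩)
      · exact Or.inr ⟨hx, m, rfl, hm⟩
      · exact Or.inl hx
    · rintro (hx | ⟨hx, m', hm', hmo⟩)
      · exact Or.inr ⟨hA, hx⟩
      · obtain rfl := Option.some.inj hm'
        exact Or.inl ⟨hx, hmo⟩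

/-- `cen` of a `castSucc` is the mark. -/
theorem cen_castSucc (m : Fin 3) : (cen m.castSucc : V p q r s) = vm m := rfl

/-- `cen 3` is the centre. -/
theorem cen_last : (cen 3 : V p q r s) = vx := rfl

/-- A central is a mark or the centre. -/
theorem cen_cases (i : Fin 4) : (∃ m : Fin 3, i = m.castSucc) ∨ i = 3 :=
  Fin.eq_castSucc_or_eq_last i

/-- The central `i` lies in `M = cluster ω c` iff `i = c`, or `i = x` in mode M. -/
theorem cen_mem_M_iff {μ : Mode} {ω : Config (E cx p q r s)} (hμ : InMode μ ω) (i : Fin 4) :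
    (cen i : V p q r s) ∈ (starGadget cx p q r s).cluster ω (vm 2) ↔ i = 2 ∨ (i = 3 ∧ μ = some 2) := by
  rcases cen_cases i with ⟨m, rfl⟩ | rfl
  · rw [cen_castSucc, vm_mem_cluster_vm_iff hμ.1]
    have h3 : (m.castSucc : Fin 4) ≠ 3 := by revert m; decide
    simp only [h3, false_and, or_false]
    revert m; decide
  · rw [cen_last, vx_mem_cluster_vm_iff' hμ]
    simp

/-- A hub lies in `M` iff `inCl μ 2`. -/
theorem inr_mem_M_iff {μ : Mode} {ω : Config (E cx p q r s)} (hμ : InMode μ ω) (h : Hub p q r s) :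
    (Sum.inr h : V p q r s) ∈ (starGadget cx p q r s).cluster ω (vm 2) ↔
      inCl μ 2 (hubType h) (hubState ω h) :=
  inr_mem_cluster_vm_iff hμ 2 h


/-! ### Edges -/

/-- The edges joining a mark to a hub are the hub's edges to that mark. -/
theorem exists_joins_vm_inr_iff (Q : E cx p q r s → Prop) (m : Fin 3) (h : Hub p q r s) :
    (∃ e, Q e ∧ (starGadget cx p q r s).Joins e (vm m) (Sum.inr h)) ↔
      ∃ i, (hubType h).marks.get i = m ∧ Q (Sum.inr ⟨h, some i⟩) := by
  constructor
  · rintro ⟨e, hQ, hj⟩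
    rcases e with k | ⟨h', j⟩
    · rcases hj with ⟨-, h2⟩ | ⟨h1, -⟩
      · exact absurd h2 (vx_ne_inr _)
      · exact absurd h1 (vm_ne_inr _ _)
    · rcases j with _ | i
      · rcases hj with ⟨h1, -⟩ | ⟨h1, -⟩
        · exact absurd h1 (vm_ne_vx _).symm
        · exact absurd h1 (vx_ne_inr _)
      · rcases hj with ⟨h1, h2⟩ | ⟨h1, -⟩
        · obtain rfl := Sum.inr.inj h2
          exact ⟨i, vm_inj.1 h1, hQ⟩
        · exact absurd h1 (vm_ne_inr _ _)
  · rintro ⟨i, hi, hQ⟩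
    refine ⟨Sum.inr ⟨h, some i⟩, hQ, Or.inl ⟨?_, rfl⟩⟩
    show vm ((hubType h).marks.get i) = vm m
    rw [hi]

/-- The edges joining the centre to a hub: its `x`-edge. -/
theorem exists_joins_vx_inr_iff (Q : E cx p q r s → Prop) (h : Hub p q r s) :
    (∃ e, Q e ∧ (starGadget cx p q r s).Joins e vx (Sum.inr h)) ↔ Q (Sum.inr ⟨h, none⟩) := by
  constructor
  · rintro ⟨e, hQ, hj⟩
    rcases e with k | ⟨h', j⟩
    · rcases hj with ⟨h1, -⟩ | ⟨h1, -⟩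
      · exact absurd h1 (vm_ne_vx _)
      · exact absurd h1 (vm_ne_inr _ _)
    · rcases j with _ | i
      · rcases hj with ⟨-, h2⟩ | ⟨h1, -⟩
        · obtain rfl := Sum.inr.inj h2
          exact hQ
        · exact absurd h1 (vx_ne_inr _)
      · rcases hj with ⟨h1, -⟩ | ⟨h1, -⟩
        · exact absurd h1 (vm_ne_vx _)
        · exact absurd h1 (vm_ne_inr _ _)
  · intro hQ
    exact ⟨Sum.inr ⟨h, none⟩, hQ, Or.inl ⟨rfl, rfl⟩⟩

/-- The edges joining two distinct centrals: the edge `c – x`, when it exists. -/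
theorem exists_joins_cen_cen_iff (Q : E cx p q r s → Prop) (i j : Fin 4) :
    (∃ e, Q e ∧ (starGadget cx p q r s).Joins e (cen i) (cen j)) ↔
      ((i = 2 ∧ j = 3) ∨ (i = 3 ∧ j = 2)) ∧ ∃ k : Fin (if cx then 1 else 0), Q (Sum.inl k) := by
  constructor
  · rintro ⟨e, hQ, hj⟩
    rcases e with k | ⟨h', j'⟩
    · refine ⟨?_, k, hQ⟩
      rcases hj with ⟨h1, h2⟩ | ⟨h1, h2⟩
      · exact Or.inl ⟨(cen_injective h1).symm, (cen_injective h2).symm⟩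
      · exact Or.inr ⟨(cen_injective h2).symm, (cen_injective h1).symm⟩
    · rcases hj with ⟨-, h2⟩ | ⟨-, h2⟩
      · exact absurd h2 Sum.inr_ne_inl
      · exact absurd h2 Sum.inr_ne_inl
  · rintro ⟨hij, k, hQ⟩
    refine ⟨Sum.inl k, hQ, ?_⟩
    rcases hij with ⟨rfl, rfl⟩ | ⟨rfl, rfl⟩
    · exact Or.inl ⟨rfl, rfl⟩
    · exact Or.inr ⟨rfl, rfl⟩

/-- The edge `c – x` exists iff `cx`. -/
theorem exists_fin_cx_iff : (∃ _k : Fin (if cx then 1 else 0), True) ↔ cx = true := by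
  cases cx <;> simp

/-- The edge `c – x` exists and is closed iff `cx` and `¬ cxOpen`. -/
theorem exists_closed_cx_iff (ω : Config (E cx p q r s)) :
    (∃ k : Fin (if cx then 1 else 0), ω (Sum.inl k) = false) ↔ cx = true ∧ ¬ cxOpen ω := by
  unfold cxOpen
  cases cx
  · simp
  · show (∃ k : Fin 1, ω (Sum.inl k) = false) ↔ true = true ∧ ¬ ∃ i : Fin 1, ω (Sum.inl i) = true
    simp only [Fin.exists_fin_one, true_and]
    simp

/-- A closed mark edge, as a statement on the hub state. -/
theorem exists_closed_mark_iff (T : HubType) (s : HubEdge T → Bool) (m : Fin 3) :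
    (∃ i, T.marks.get i = m ∧ s (some i) = false) ↔ hasM T m ∧ ¬ mo s m := by
  decide +revert +kernel

/-- The existence of a mark edge, as a statement on the type. -/
theorem exists_mark_iff (T : HubType) (m : Fin 3) : (∃ i, T.marks.get i = m) ↔ hasM T m := by
  decide +revert +kernel

/-! ### Connectivity between centrals -/

/-- Two centrals are connected iff equal, or one is the centre and the other the mark it attaches
to. -/
theorem conn_cen_cen_iff {μ : Mode} {ω : Config (E cx p q r s)} (hμ : InMode μ ω) (i j : Fin 4) :
    (starGadget cx p q r s).Conn ω (cen i) (cen j) ↔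
      i = j ∨ (i = 3 ∧ ∃ m, j = m.castSucc ∧ μ = some m) ∨
        (j = 3 ∧ ∃ m, i = m.castSucc ∧ μ = some m) := by
  rcases cen_cases i with ⟨m, rfl⟩ | rfl <;> rcases cen_cases j with ⟨m', rfl⟩ | rfl
  · rw [cen_castSucc, cen_castSucc, ← mem_cluster, vm_mem_cluster_vm_iff hμ.1]
    have h1 : ∀ m : Fin 3, (m.castSucc : Fin 4) ≠ 3 := by decide
    simp only [h1, false_and, or_false, Fin.castSucc_inj]
    rw [eq_comm]
  · rw [cen_castSucc, cen_last, ← mem_cluster, vx_mem_cluster_vm_iff' hμ]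
    have h1 : ∀ m : Fin 3, (m.castSucc : Fin 4) ≠ 3 := by decide
    simp [h1, Fin.castSucc_inj]
  · rw [cen_last, cen_castSucc, conn_comm, ← mem_cluster, vx_mem_cluster_vm_iff' hμ]
    have h1 : ∀ m : Fin 3, (m.castSucc : Fin 4) ≠ 3 := by decide
    have h2 : ∀ m : Fin 3, (3 : Fin 4) ≠ m.castSucc := by decide
    simp [h1, h2, Fin.castSucc_inj]
  · simp [Conn.refl]

/-! ### The H-adjacency tables -/

set_option synthInstance.maxSize 4096 in
/-- **Central–central H-adjacency** is the constant table `T2` (for distinct centrals). -/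
theorem hadj_cen_cen_iff {μ : Mode} {ω : Config (E cx p q r s)} (hμ : InMode μ ω) {β : Bool}
    (hβ : cxOpen ω ↔ β = true) (i j : Fin 4) (hij : i ≠ j) :
    (starGadget cx p q r s).HAdj ω (vm 2) (cen i) (cen j) ↔ T2 cx β μ i j = true := by
  unfold HAdj
  rw [cen_mem_M_iff hμ, cen_mem_M_iff hμ, conn_cen_cen_iff hμ]
  have e1 : (∃ e, ω e = false ∧ (starGadget cx p q r s).Joins e (cen i) (cen j)) ↔
      ((i = 2 ∧ j = 3) ∨ (i = 3 ∧ j = 2)) ∧ cx = true ∧ β = false := by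
    rw [exists_joins_cen_cen_iff, exists_closed_cx_iff, hβ]
    cases β <;> simp
  have e2 : (∃ e, (starGadget cx p q r s).Joins e (cen i) (cen j)) ↔
      ((i = 2 ∧ j = 3) ∨ (i = 3 ∧ j = 2)) ∧ cx = true := by
    have := exists_joins_cen_cen_iff (cx := cx) (p := p) (q := q) (r := r) (s := s)
      (fun _ => True) i j
    simp only [true_and] at this
    rw [this, exists_fin_cx_iff]
  rw [e1, e2]
  clear e1 e2 hβ hμ ω
  revert hij
  revert i j
  revert cx β μ
  decide +kernel

set_option synthInstance.maxSize 4096 in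
/-- The raw H-adjacency formula of a central to a hub (the three disjuncts of `HAdj` with the
memberships, edges and connectivity of the gadget substituted) is the profile formula `Hf`: a
finite check over the modes, the centrals, the types and the states. -/
theorem hf_raw (μ : Mode) (i : Fin 4) (T : HubType) (s : HubEdge T → Bool) :
    ((i = 2 ∨ i = 3 ∧ μ = some 2) ∧ inCl μ 2 T s ∧
        (i = 3 ∧ ¬ xo s ∨ ∃ m, i = m.castSucc ∧ hasM T m ∧ ¬ mo s m)) ∨
      ((i = 2 ∨ i = 3 ∧ μ = some 2 ↔ ¬ inCl μ 2 T s) ∧ (i = 3 ∨ ∃ m, i = m.castSucc ∧ hasM T m)) ∨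
        (¬ (i = 2 ∨ i = 3 ∧ μ = some 2) ∧ ¬ inCl μ 2 T s ∧
          (i = 3 ∧ (xo s ∨ ¬ xo s ∧ ∃ m, μ = some m ∧ mo s m) ∨
            ∃ m, i = m.castSucc ∧ inCl μ m T s)) ↔
      Hf μ i T s := by
  decide +revert +kernel

/-- **Central–hub H-adjacency** is the profile formula `Hf`. -/
theorem hadj_cen_inr_iff {μ : Mode} {ω : Config (E cx p q r s)} (hμ : InMode μ ω) (i : Fin 4)
    (h : Hub p q r s) :
    (starGadget cx p q r s).HAdj ω (vm 2) (cen i) (Sum.inr h) ↔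
      Hf μ i (hubType h) (hubState ω h) := by
  unfold HAdj
  rw [cen_mem_M_iff hμ, inr_mem_M_iff hμ]
  -- the edges between the central `i` and the hub
  have e1 : (∃ e, ω e = false ∧ (starGadget cx p q r s).Joins e (cen i) (Sum.inr h)) ↔
      (i = 3 ∧ ¬ xo (hubState ω h)) ∨
        ∃ m, i = m.castSucc ∧ hasM (hubType h) m ∧ ¬ mo (hubState ω h) m := by
    rcases cen_cases i with ⟨m, rfl⟩ | rfl
    · rw [cen_castSucc, exists_joins_vm_inr_iff]
      refine (exists_closed_mark_iff (hubType h) (hubState ω h) m).trans ?_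
      have h1 : ∀ m : Fin 3, (m.castSucc : Fin 4) ≠ 3 := by decide
      simp [h1, Fin.castSucc_inj]
    · rw [cen_last, exists_joins_vx_inr_iff]
      have h1 : ∀ m : Fin 3, (3 : Fin 4) ≠ m.castSucc := by decide
      simp only [h1, false_and, exists_false, or_false, true_and]
      show ω (Sum.inr ⟨h, none⟩) = false ↔ ¬ ω (Sum.inr ⟨h, none⟩) = true
      cases ω (Sum.inr ⟨h, none⟩) <;> simp
  have e2 : (∃ e, (starGadget cx p q r s).Joins e (cen i) (Sum.inr h)) ↔
      i = 3 ∨ ∃ m, i = m.castSucc ∧ hasM (hubType h) m := by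
    rcases cen_cases i with ⟨m, rfl⟩ | rfl
    · rw [cen_castSucc]
      have := exists_joins_vm_inr_iff (cx := cx) (p := p) (q := q) (r := r) (s := s)
        (fun _ => True) m h
      simp only [true_and, and_true] at this
      rw [this, exists_mark_iff]
      have h1 : ∀ m : Fin 3, (m.castSucc : Fin 4) ≠ 3 := by decide
      simp [h1, Fin.castSucc_inj]
    · rw [cen_last]
      have := exists_joins_vx_inr_iff (cx := cx) (p := p) (q := q) (r := r) (s := s)
        (fun _ => True) h
      simp only [true_and] at this
      rw [this]
      simp
  -- connectivity between the central `i` and the hub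
  have e3 : (starGadget cx p q r s).Conn ω (cen i) (Sum.inr h) ↔
      (i = 3 ∧ (xo (hubState ω h) ∨
        (¬ xo (hubState ω h) ∧ ∃ m, μ = some m ∧ mo (hubState ω h) m))) ∨
        ∃ m, i = m.castSucc ∧ inCl μ m (hubType h) (hubState ω h) := by
    rcases cen_cases i with ⟨m, rfl⟩ | rfl
    · rw [cen_castSucc, ← mem_cluster, inr_mem_cluster_vm_iff hμ]
      have h1 : ∀ m : Fin 3, (m.castSucc : Fin 4) ≠ 3 := by decide
      simp [h1, Fin.castSucc_inj]
    · rw [cen_last, ← mem_cluster, inr_mem_cluster_vx_iff hμ]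
      have h1 : ∀ m : Fin 3, (3 : Fin 4) ≠ m.castSucc := by decide
      simp [h1]
  rw [e1, e2, e3]
  exact hf_raw μ i (hubType h) (hubState ω h)

/-! ### The avoided sets -/

/-- The avoided vertex set: nothing, or the open cluster of the mark `m`. -/
def Xset (ω : Config (E cx p q r s)) : Option (Fin 3) → Set (V p q r s)
  | none => ∅
  | some m => (starGadget cx p q r s).cluster ω (vm m)

/-- A central avoids `X` iff `nx` says so. -/
theorem cen_not_mem_Xset_iff {μ : Mode} {ω : Config (E cx p q r s)} (hμ : InMode μ ω)
    (X : Option (Fin 3)) (i : Fin 4) : (cen i : V p q r s) ∉ Xset ω X ↔ nx X μ i = true := by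
  rcases X with _ | m
  · simp [Xset, nx]
  · simp only [Xset, nx, Option.some.injEq, forall_eq', decide_eq_true_eq]
    rcases cen_cases i with ⟨m', rfl⟩ | rfl
    · rw [cen_castSucc, vm_mem_cluster_vm_iff hμ.1]
      have h1 : ∀ m : Fin 3, (m.castSucc : Fin 4) ≠ 3 := by decide
      simp [h1, Fin.castSucc_inj]
    · rw [cen_last, vx_mem_cluster_vm_iff' hμ]
      have h1 : ∀ m : Fin 3, (3 : Fin 4) ≠ m.castSucc := by decide
      simp [h1]

/-- A hub avoids `X` iff `inX` fails. -/
theorem inr_not_mem_Xset_iff {μ : Mode} {ω : Config (E cx p q r s)} (hμ : InMode μ ω)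
    (X : Option (Fin 3)) (h : Hub p q r s) :
    (Sum.inr h : V p q r s) ∉ Xset ω X ↔ ¬ inX μ X (hubType h) (hubState ω h) := by
  rcases X with _ | m
  · simp [Xset, inX]
  · simp only [Xset, inX, Option.some.injEq, exists_eq_left']
    rw [inr_mem_cluster_vm_iff hμ]

/-- `Xset` is a union of open clusters: closed under connectivity. -/
theorem xset_closed (ω : Config (E cx p q r s)) (X : Option (Fin 3)) :
    ∀ u v, u ∉ Xset ω X → (starGadget cx p q r s).Conn ω u v → v ∉ Xset ω X := by
  rcases X with _ | m
  · simp [Xset]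
  · intro u v hu huv hv
    exact hu ((hv : (starGadget cx p q r s).Conn ω (vm m) v).trans huv.symm)

/-- H-connectivity is H-connectivity avoiding nothing. -/
theorem hConn_iff_hConnAvoid_empty (ω : Config (E cx p q r s)) (u v : V p q r s) :
    (starGadget cx p q r s).HConn ω (vm 2) u v ↔
      (starGadget cx p q r s).HConnAvoid ω (vm 2) (Xset ω none) u v := by
  unfold HConn HConnAvoid
  constructor
  · intro h
    induction h with
    | refl => exact Relation.ReflTransGen.refl
    | tail _ hxy ih => exact ih.tail ⟨hxy, Set.notMem_empty _, Set.notMem_empty _⟩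
  · intro h
    induction h with
    | refl => exact Relation.ReflTransGen.refl
    | tail _ hxy ih => exact ih.tail hxy.1

end PercRepro.StarGadgetGraph
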